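import Literature.IUT.HodgeArakelov.EtaleThetaDataOfSettingRootHypOfCor28iIntrinsic
import Literature.IUT.HodgeArakelov.EtaleThetaDataOfSettingRootHypOfCor28iInner
import Literature.AnabelianGeometry.EtaleTheta.Discharge.Sec2InnerInducesOnTheta

/-!
# GAP row G-w5d169-2 (`hroot`), ROUTE 2 companion-free, v2: `Dtau`-stability UP TO AN INNER AUTOMORPHISM from `Π^tp_X̲̲`

S. Mochizuki, *The étale theta function …*, Publ. RIMS **45** (2009) [EtTh] (refereed): Cor. 2.8 (i) p. 42 ("`γ` …
induces an automorphism of `Δ_Θ` … preserves the property that `η̲̈^{Θ,l·ℤ×μ₂}` be of standard type"), (iii) p. 42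
("if `γ` arises from an inner automorphism … then `γ` preserves `η̲̈^{Θ,l·ℤ}`"), Def. 2.7 p. 41, Prop. 2.4 p. 38
[cite: MochizukiEtTh2009, Cor 2.8(i) p.42]; [IUTchII] Prop. 1.4 p. 27 / Prop. 3.4 (i) p. 91 (claim key `Mochizuki2012`,
DISPUTED, D-0012) [cite: Mochizuki2012, Prop 1.4 p.27].

abc-iut cell (block C / W6 seat abc-iut-w6-d051 gen 4; GAP-LEDGER row **G-w5d169-2**, SUPPLIER ROUTE 2; FINDING
F-w5d118g5-1 of abc-iut-w5-d118 / L2-lead R338: F-0640 `Cor28_i` conditions on EXACT `Dtau`-stability, and inner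
automorphisms from `ι(Π^tp_X̲̲)` stabilise the Prop 2.4 tower but move the two chosen decomposition groups, so the v1
binder «`Dtau` exactly stable for EVERY tower-stabilising `Γ`» of `rootHyp_of_cor28_i_intrinsic` (p445736) /
`rootHyp_of_cor28_i` (p443943) is vacuously applicable at genuine data).  PROOF-ONLY (0 def, no instance, no named
fact).  In the companion-free variant the repair lives on the `Π^tp_C` side ALONE: the core closer
`rootHyp_of_eqUpToRootOfUnity_ofEmbedding` (p445736) binds no `Dtau` hypothesis — it takes Cor. 2.8 (i)'s CONCLUSION for
one pair `(Γ, Γ_Θ)` — and that conclusion is INSENSITIVE to composing `Γ` with an inner automorphism `γ_x`,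
`x ∈ Π^tp_X̲̲` of `T` (abc-iut-L2-t2's `ofEmbedding_transport_inner_rootLZMu2`: `γ_x` preserves `η̲̈^{Θ,l·ℤ×μ₂}` exactly,
Cor. 2.8 (iii); `transport_trans`; `InducesOnTheta.unique`):
* `rootHyp_of_eqUpToRootOfUnity_ofEmbedding_inner` — `hroot` at `α` from Cor. 2.8 (i)'s conclusion for the ADJUSTED pair
  `(Γ ≫ γ_x, Γ_Θ')`, `Γ` extending `α⁻¹` through `ι` on `Π^tp_X̲̲`, `x ∈ T.tp T.PiXuu`;
* **`rootHyp_of_cor28_i_intrinsic_innerAdjust`** — `hroot` for every `α` from F-0609 `T.Prop24` + F-0640 `Cor28_i` BY NAME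
  with `hDtau` in abc-iut-w5-d118's v2-A shape (p445404): «every tower-stabilising `Γ` becomes `Dtau`-stabilising after ONE
  inner adjustment `γ_{ι u}`, `u ∈ Π^tp_X̲̲`» (print's "`γ` maps `τ` to `τ^{±1}`" with a chosen lift); other residual binders
  as in p445736: `IsOpenEmbedding ι`, `IsStandard`, `InducesOnTheta`-existence for tower-stabilising `Γ`, `hq` — still NO
  `range ι = T.tp T.PiX`, NO `γ(Δ^tp_X) = Δ^tp_X`, NO theta companion.  abc-iut-w5-d118's tower bookkeeping
  (`map_innerAutTop_tower_of_mem_Huu`, `map_PiYdduu_eq`) is consumed BY NAME.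
HONEST FRAMING: whether ONE inner adjustment makes BOTH chosen groups exactly stable at genuine data is print's
«τ ↦ τ^{±1}» read with a chosen lift (census item v2-B, L2-t2's call); nothing of [IUTchII] asserted; no side taken on
[IUTchIII] Cor. 3.12; typed ≠ proved.
-/

noncomputable section

open Topology

namespace Literature.IUT.HodgeArakelov

namespace EtaleThetaDataOfSetting

open Literature.AnabelianGeometry.EtaleTheta ThetaCovers
open Literature.AnabelianGeometry.EtaleTheta CohomologySystemOfContH1

universe u

variable {p : ℕ} [Fact p.Prime] {D : Literature.AnabelianGeometry.EtaleTheta.ThetaSetting p}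
  {E : D.EtaleThetaData} {l : ℕ} (C : E.DoubleUnderline l) (hq : IsQuotientMap D.toTheta)
  (α : (Pi C) ≃ₜ* (Pi C)) {T : TemperedCoverData.{u} l} (ε : C.OrbitEmbedding T)
  [(PiYdd C).Normal] [hN : D.GtpYdd.Normal] {N : ℕ+} (μ : D.CyclotomeMod l N) (hC : D.Compat) (hS : D.Sec2Hyps)
  (h15 : D.Prop15iii E hC) (L : C.CuspLabels) (R : RigidData.{0} N l) (hR : R = C.rigidData μ hC hS h15 L)
  (h218i : R.Cor218_i)

/-- **Core, inner-adjusted**: let `Γ ∈ Aut_top(Π^tp_C)` extend `α⁻¹` through `ι` on `Π^tp_X̲̲` and induce `Γ_Θ`; if Cor. 2.8 (i)'s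
conclusion «`η̲̈^{Θ,l·ℤ×μ₂}` = its transport up to an `l`-th root of unity» holds for the ADJUSTED pair `(Γ ≫ γ_x, Γ_Θ')`,
`x ∈ Π^tp_X̲̲` of `T` (`Γ_Θ'` induced), then it holds for `(Γ, Γ_Θ)` itself — `γ_x` preserves `η̲̈^{Θ,l·ℤ×μ₂}` exactly
(Cor. 2.8 (iii), abc-iut-L2-t2) and `Γ_Θ' = Γ_Θ ≫ act x` (`InducesOnTheta.unique`) — so `hroot` holds at `α`
(`rootHyp_of_eqUpToRootOfUnity_ofEmbedding`, p445736). [cite: MochizukiEtTh2009, Cor 2.8(iii) p.42] -/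
theorem rootHyp_of_eqUpToRootOfUnity_ofEmbedding_inner {Γ : T.Gtp ≃ₜ* T.Gtp}
    (ΓΘ : (ThetaOrbitData.ofEmbedding ε hC hS).DeltaTheta ≃* (ThetaOrbitData.ofEmbedding ε hC hS).DeltaTheta)
    (hind : (ThetaOrbitData.ofEmbedding ε hC hS).InducesOnTheta Γ ΓΘ) (hΓ : ∀ x : Pi C, Γ (ε.ι x) = ε.ι (α.symm x))
    (hYuu : (T.PiYddtp ⊓ T.tp T.PiXuu).map Γ.toMulEquiv.toMonoidHom = T.PiYddtp ⊓ T.tp T.PiXuu)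
    {x : T.Gtp} (hx : x ∈ T.tp T.PiXuu)
    (ΓΘ' : (ThetaOrbitData.ofEmbedding ε hC hS).DeltaTheta ≃* (ThetaOrbitData.ofEmbedding ε hC hS).DeltaTheta)
    (hind' : (ThetaOrbitData.ofEmbedding ε hC hS).InducesOnTheta (Γ.trans (ThetaOrbitData.innerAutTop x)) ΓΘ')
    (hYuu' : (T.PiYddtp ⊓ T.tp T.PiXuu).map (Γ.trans (ThetaOrbitData.innerAutTop x)).toMulEquiv.toMonoidHom =
      T.PiYddtp ⊓ T.tp T.PiXuu)
    (hE' : (ThetaOrbitData.ofEmbedding ε hC hS).EqUpToRootOfUnity l _ (ThetaOrbitData.ofEmbedding ε hC hS).rootLZMu2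
      ((ThetaOrbitData.ofEmbedding ε hC hS).transport _ (Γ.trans (ThetaOrbitData.innerAutTop x)) hYuu' ΓΘ'
        (ThetaOrbitData.ofEmbedding ε hC hS).rootLZMu2)) :
    ∃ τ : Pi C, ∃ ε' : (coh C).H1 ⊤, l • ε' = 0 ∧
      autActTopOfCor218i C hq μ hC hS h15 L R hR h218i α (rootTop C) =
        h1TopConjEquiv (phi C) (D.lDeltaTheta l) (PiYdd C) τ (rootTop C) + ε' := by
  obtain ⟨ΓΘx, hYuux, hindx, -, hpres⟩ := ThetaOrbitData.ofEmbedding_inner_preserves_rootLZMu2 ε hC hS hx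
  have huniq : ΓΘ' = ΓΘ.trans ΓΘx := hind'.unique (hind.trans hindx)
  subst huniq
  rw [(ThetaOrbitData.ofEmbedding ε hC hS).transport_trans _ Γ (ThetaOrbitData.innerAutTop x) hYuu hYuux hYuu' ΓΘ ΓΘx,
    hpres] at hE'
  exact rootHyp_of_eqUpToRootOfUnity_ofEmbedding C hq α ε μ hC hS h15 L R hR h218i ΓΘ hind hΓ hYuu hE'

/-- **G-w5d169-2 ALONG ROUTE 2, COMPANION-FREE, v2 (`Dtau` up to inner adjustment)**: `hroot` for every `α` from the
NAMED FACTS F-0609 `T.Prop24` and F-0640 `Cor28_i` at `ofEmbedding ε hC hS`, under `IsOpenEmbedding ι`, standard type,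
`InducesOnTheta`-existence for tower-stabilising `Γ`, `hq`, and «every tower-stabilising `Γ ∈ Aut_top(Π^tp_C)` maps the
two chosen decomposition groups `Dtau` into `Dtau` AFTER one inner adjustment `γ_{ι u}`, `u ∈ Π^tp_X̲̲`» (abc-iut-w5-d118's
v2-A shape; "`γ` maps `τ` to `τ^{±1}`").  Proof: Prop 2.4 extension `Γ` of `α⁻¹`; `Γ ≫ γ_{ι u}` again stabilises the tower
(abc-iut-w5-d118's `map_innerAutTop_tower_of_mem_Huu`) and induces `Γ_Θ ≫ act (ι u)`; Cor 2.8 (i) there; then the core.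
[cite: MochizukiEtTh2009, Cor 2.8(i) p.42] -/
theorem rootHyp_of_cor28_i_intrinsic_innerAdjust (hιe : IsOpenEmbedding ε.ι) (h24 : T.Prop24)
    (hstd : (ThetaOrbitData.ofEmbedding ε hC hS).IsStandard) (h28 : (ThetaOrbitData.ofEmbedding ε hC hS).Cor28_i)
    (hDtau : ∀ Γ : T.Gtp ≃ₜ* T.Gtp, (∀ S ∈ T.tower, S.map Γ.toMulEquiv.toMonoidHom = S) →
      ∃ u ∈ C.Huu, ∀ Dt ∈ (ThetaOrbitData.ofEmbedding ε hC hS).Dtau,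
        Dt.map (Γ.trans (ThetaOrbitData.innerAutTop (ε.ι u))).toMulEquiv.toMonoidHom ∈
          (ThetaOrbitData.ofEmbedding ε hC hS).Dtau)
    (hInd : ∀ Γ : T.Gtp ≃ₜ* T.Gtp, (∀ S ∈ T.tower, S.map Γ.toMulEquiv.toMonoidHom = S) →
      ∃ ΓΘ : (ThetaOrbitData.ofEmbedding ε hC hS).DeltaTheta ≃* (ThetaOrbitData.ofEmbedding ε hC hS).DeltaTheta,
        (ThetaOrbitData.ofEmbedding ε hC hS).InducesOnTheta Γ ΓΘ) :
    ∃ τ : Pi C, ∃ ε' : (coh C).H1 ⊤, l • ε' = 0 ∧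
      autActTopOfCor218i C hq μ hC hS h15 L R hR h218i α (rootTop C) =
        h1TopConjEquiv (phi C) (D.lDeltaTheta l) (PiYdd C) τ (rootTop C) + ε' := by
  obtain ⟨Γ, hΓtower, hΓ⟩ := exists_tower_extension_of_prop24 C ε hιe h24 α.symm
  obtain ⟨u, hu, hDt⟩ := hDtau Γ hΓtower
  obtain ⟨ΓΘ, hind⟩ := hInd Γ hΓtower
  have hx : ε.ι u ∈ T.tp T.PiXuu := ε.map_Huu.le ⟨u, hu, rfl⟩
  obtain ⟨ΓΘx, -, hindx, -, -⟩ := ThetaOrbitData.ofEmbedding_inner_preserves_rootLZMu2 ε hC hS hx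
  have hxtower := map_innerAutTop_tower_of_mem_Huu ε hu
  have hΓ'tower : ∀ S ∈ T.tower,
      S.map (Γ.trans (ThetaOrbitData.innerAutTop (ε.ι u))).toMulEquiv.toMonoidHom = S :=
    fun S hS' => ThetaOrbitData.map_trans_eq S (hΓtower S hS') (hxtower S hS')
  have hY : T.PiYddtp.map Γ.toMulEquiv.toMonoidHom = T.PiYddtp := hΓtower _ (by simp [TemperedCoverData.tower])
  have hU : (T.tp T.PiXuu).map Γ.toMulEquiv.toMonoidHom = T.tp T.PiXuu :=
    hΓtower _ (by simp [TemperedCoverData.tower])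
  have hY' : T.PiYddtp.map (Γ.trans (ThetaOrbitData.innerAutTop (ε.ι u))).toMulEquiv.toMonoidHom = T.PiYddtp :=
    hΓ'tower _ (by simp [TemperedCoverData.tower])
  have hU' : (T.tp T.PiXuu).map (Γ.trans (ThetaOrbitData.innerAutTop (ε.ι u))).toMulEquiv.toMonoidHom =
      T.tp T.PiXuu := hΓ'tower _ (by simp [TemperedCoverData.tower])
  have hYuu := ThetaSetting.EtaleThetaData.DoubleUnderline.OrbitEmbedding.map_PiYdduu_eq hY hU
  have hYuu' := ThetaSetting.EtaleThetaData.DoubleUnderline.OrbitEmbedding.map_PiYdduu_eq hY' hU'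
  have hind' := hind.trans hindx
  exact rootHyp_of_eqUpToRootOfUnity_ofEmbedding_inner C hq α ε μ hC hS h15 L R hR h218i ΓΘ hind hΓ hYuu hx
    (ΓΘ.trans ΓΘx) hind' hYuu' ((h28 hstd _ _ hind' hDt hY' hYuu').2.1 hΓ'tower)

end EtaleThetaDataOfSetting

end Literature.IUT.HodgeArakelov

end
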